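import Summits.CriticalPhenomena.PercolationContinuityZ3.Theorems.PercNearOneGluingNoHeavyQuantSliceHeavy
import HarnessLib

/-!
# QUANT lane R8, T-DEC: Conjecture SL beyond heavy decompositions — the LIGHT credit pairs whose shifted copy stays below the layer,
# reduced to ONE typed 4-atom statement `LawDec.LightTwoBlobDEC` (exact census 0 failures), and the light pairs with a self-sufficient `lo`

builds on p205010 (kernel theorem, internal audit signed; external expert review pending)

Statement + support file (`--supports stmt-CriticalPhenomena-4575`), QUANT lane typer seat prim-quant-stmt (gen 22), rung R8 of
`run/shared/lean/prim/quant/LADDER.md`.  Definitions `LawDec.BValidAt` / `LawDec.BDECAtT` (heavy validity + the two extra branches below), the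
`@[conjecture]` `LawDec.LightTwoBlobDEC`, theorems with standard axioms, no sorries.  Continues `…QuantSliceHeavy` (typer g22:
`slice_decAtT_of_hdecAtT` — SL for data with no light credit pair).

THE DECOMPOSITION OF CONJECTURE SL (`LawDec.SliceClosed`) after gen 22.  A layer-`j′` DEC datum of `μ` has components of five kinds:
(S) points, (G) giant-heavy pairs, heavy (N) pairs — KERNEL (`…QuantSliceHeavy`); light (N) pairs `{lo, hi; γ}` (`γ < x`) split further:
(L0) `lo` self-sufficient (`T ≤ 2lo` or `lo ≥ j′+1`; any gate, e.g. `γ ≤ x²`): the pair is two self-sufficient points — KERNEL here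
(`slice_selfPair_decAtT`); (LB) `hi + a ≤ j′` ("light, below the layer after the shift"): the slice is the 4-atom law `LAW2[hi−lo, γ; a, g]`
shifted by `lo`, and SL's conclusion for this piece at the credit target is EXACTLY the typed statement `LightTwoBlobDEC` below (exact LP
census, seat prim-quant-stmt-g22 explore/caseA_census.py: 0 failures — numbers in the docstring); (LS) `hi + a ≥ j′+1 > hi` (light
straddler after the shift): FALSE in isolation (23 / 1 878 exact instances fail, all with `a ≤ 2`, `hi ≥ j′−1`, `γ` just below `x`) — this is
where SL's second hypothesis (layer `j′ − a`) is consumed, and it is the only place.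
* `LawDec.BValidAt x T j′ a lo hi g` := `HValidAt` ∨ (L0) ∨ (LB);  `LawDec.BDECAtT x T j′ M a μ` — a datum with no light straddler.
* **`LawDec.LightTwoBlobDEC`** (`@[conjecture]`): for `0 < x < 1`, `x² < γ < x ≤ g ≤ 1`, `a, b ≥ 1`, every layer `j″ ≥ a + b`:
  `DECAtT x (b·κ_x(γ) + a·g) j″ (b + a) LAW2[b, γ; a, g]`, `κ_x(γ) = (γ − x²)/(1 − x)` — the law of `b·Bern(γ) + a·Bern(g)` is DEC at its ARCH
  CREDIT (below its mean) with no giants.  NOT Theorem A (`x·(a+b) ≤ mean` fails when `a(g−x) < b(x−γ)`); census structure: in 85 % of the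
  instances only atom `0` is low and the certificate is the capacity inequality `(1−γ)(1−g) ≤ Σ_h P(h)(1−γ_h)/γ_h` over the compatible
  absorbers `h ∈ {a+b, a [c < a], b [c < b]}`; otherwise exactly one of `a`, `b` is low and ships to `a+b`.
* **`LawDec.slice_decAtT_of_bdecAtT : LightTwoBlobDEC → BDECAtT x T j′ M a μ → DECAtT x (T + a·g) j′ (M + a) (slice μ a g)`**
  (`0 < x < 1`, `x ≤ g ≤ 1`, `a ≥ 1`) — SL with ONE hypothesis for every datum without light straddlers, modulo the typed 4-atom statement.

[this work]; DEC rules ARCH-TREES-G49 §2.2 / DEC-TAMP-G50 §3.1, DEC-CLOSURE-G53 §3.2 (this lane).  The gluing rows served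
[cite: KozmaNitzan2024, Conjecture 3 (p. 15)]; product measure [cite: Grimmett1999, §1.3 p. 10].
-/

noncomputable section

namespace Summit.CriticalPhenomena.PercolationContinuityZ3.Theorems

namespace Quant

open Finset

/-- the two-point law `{lo, hi; g}` (as in `…QuantLawDEC`) -/
local notation3 "TP[" lo ", " hi ", " g ", " h "]" =>
  (g : ℝ) * (if (h : ℕ) = (hi : ℕ) then (1 : ℝ) else 0) + (1 - (g : ℝ)) * (if (h : ℕ) = (lo : ℕ) then (1 : ℝ) else 0)

/-- the two-blob law `(1−u)(1−v)δ₀ + u(1−v)δ_a + (1−u)vδ_b + uvδ_{a+b}` evaluated at `h` (as in `…QuantBlobDecTwoLawParts`) -/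
local notation3 "LAW2[" a ", " u ", " b ", " v ", " h "]" =>
  (1 - (u : ℝ)) * (1 - (v : ℝ)) * (if (h : ℕ) = 0 then (1 : ℝ) else 0)
    + (u : ℝ) * (1 - (v : ℝ)) * (if (h : ℕ) = (a : ℕ) then (1 : ℝ) else 0)
    + (1 - (u : ℝ)) * (v : ℝ) * (if (h : ℕ) = (b : ℕ) then (1 : ℝ) else 0)
    + (u : ℝ) * (v : ℝ) * (if (h : ℕ) = (a : ℕ) + (b : ℕ) then (1 : ℝ) else 0)

namespace LawDec

/-! ### The typed 4-atom statement -/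

/-- **CONJECTURE LIGHT-TWO-BLOB-DEC (the light piece of SL below the layer).**  For a floor `0 < x < 1`, a LIGHT gate `x² < γ < x`, a heavy
gate `x ≤ g ≤ 1`, sizes `a, b ≥ 1` and every layer `j″ ≥ a + b` (no giants): the law of `b·Bern(γ) + a·Bern(g)` — atoms `0, b, a, a+b` with
masses `(1−γ)(1−g), γ(1−g), (1−γ)g, γg` — is DEC(j″) at the CREDIT target `b·(γ − x²)/(1 − x) + a·g` on `{0..b+a}`.  EVIDENCE (exact LP =
`LawDec.decAtT_iff_flowAtT`'s LP, census-2's `dec_lp`; quant/prim-quant-stmt-g22/explore/caseA_census.py, caseA_cert.py, caseA_tight2.py):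
0 failures on the full grids `x, γ, g ∈ (1/12)ℤ, a, b ≤ 8` (7 168 instances) and `(1/20)ℤ, a, b ≤ 10` (59 400), on 47 943 random instances
(denominators ≤ 30, sizes ≤ 12) and on 174 943 adversarial small-floor instances (x ≤ 1/6, denominators ≤ 600, sizes ≤ 40).  CERTIFICATE (always
sufficient in the census): when only atom `0` is low, the capacity inequality `(1−γ)(1−g) ≤ Σ_h P(h)·(1−γ_h)/γ_h` over the compatible
absorbers `h ∈ {a+b} ∪ {a : c < a} ∪ {b : c < b}` (`γ_h = max(c/h, x² + (1−x)c/h)`, `c` the target); when `a` (resp. `b`) is low it ships to `a+b`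
first (then to the other mid) and atom `0` takes the residual capacities.  CAUTION: the relative margin has infimum `0` as `x → 0`
(≈ 7·10⁻⁶ at x = 1/300, γ = 1/600; ≈ 2·10⁻³ at x = 1/20) — an exact proof, no slack to spend (cf. `OneBigCert`'s infimum-0 corner).
WHY IT MATTERS: `slice_decAtT_of_bdecAtT` — with it, Conjecture SL holds from the layer-`j′` datum alone whenever that datum has no light
straddler. [this work] [status: open] -/
@[conjecture] def LightTwoBlobDEC : Prop :=
  ∀ (x γ g : ℝ) (a b j'' : ℕ), 0 < x → x < 1 → x ^ 2 < γ → γ < x → x ≤ g → g ≤ 1 → 1 ≤ a → 1 ≤ b → a + b ≤ j'' →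
    DECAtT x ((b : ℝ) * ((γ - x ^ 2) / (1 - x)) + (a : ℝ) * g) j'' (b + a) (fun h => LAW2[b, γ, a, g, h])

/-! ### Validity without light straddlers -/

/-- **validity without a light straddler (relative to the blob size `a`)**: heavy validity, or a pair whose `lo` is self-sufficient (any gate),
or a light credit pair whose shifted copy stays below the layer (`hi + a ≤ j′`, `x² < g < x`). [this work] -/
def BValidAt (x T : ℝ) (j' a lo hi : ℕ) (g : ℝ) : Prop :=
  HValidAt x T j' lo hi g ∨
  (lo < hi ∧ (T ≤ 2 * (lo : ℝ) ∨ j' + 1 ≤ lo)) ∨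
  (lo < hi ∧ hi + a ≤ j' ∧ x ^ 2 < g ∧ g < x ∧ T ≤ 2 * (lo : ℝ) + ((hi : ℝ) - lo) * ((g - x ^ 2) / (1 - x)))

/-- **DEC(j′) at target `T` by a datum WITHOUT LIGHT STRADDLERS** (relative to `a`). [this work] -/
def BDECAtT (x T : ℝ) (j' M a : ℕ) (μ : ℕ → ℝ) : Prop :=
  ∃ (ρ : Type) (_ : Fintype ρ) (lam g : ρ → ℝ) (lo hi : ρ → ℕ),
    (∀ r, 0 ≤ lam r) ∧ (∑ r, lam r = 1) ∧ (∀ r, 0 ≤ g r ∧ g r ≤ 1) ∧ (∀ r, lo r ≤ hi r) ∧ (∀ r, hi r ≤ M) ∧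
    (∀ h, μ h = ∑ r, lam r * TP[lo r, hi r, g r, h]) ∧
    (∀ r, 0 < lam r → BValidAt x T j' a (lo r) (hi r) (g r))

/-- a heavy datum has no light straddler. [this work] -/
theorem HDECAtT.bdecAtT {x T : ℝ} {j' M : ℕ} {μ : ℕ → ℝ} (h : HDECAtT x T j' M μ) (a : ℕ) : BDECAtT x T j' M a μ := by
  obtain ⟨ρ, hρ, lam, g, lo, hi, h0, h1, hg, hlohi, hhi, hμ, hval⟩ := h
  exact ⟨ρ, hρ, lam, g, lo, hi, h0, h1, hg, hlohi, hhi, hμ, fun r hr => Or.inl (hval r hr)⟩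

/-! ### The two new pieces -/

/-- **(L0)-piece**: a pair `{lo, hi; γ}` with `lo` self-sufficient is `(1−γ)·δ_lo + γ·δ_hi`, and both points slice to valid single components
(`slice_point_decAtT`). [this work] -/
theorem slice_selfPair_decAtT (x T g γ : ℝ) (j' M lo hi a : ℕ) (hxg : x ≤ g) (hg0 : 0 ≤ g) (hg1 : g ≤ 1) (hγ : 0 ≤ γ ∧ γ ≤ 1)
    (ha : 1 ≤ a) (hlt : lo < hi) (hhi : hi ≤ M) (hS : T ≤ 2 * (lo : ℝ) ∨ j' + 1 ≤ lo) :
    DECAtT x (T + (a : ℝ) * g) j' (M + a) (slice (fun t => TP[lo, hi, γ, t]) a g) := by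
  have h₁ := slice_point_decAtT x T g γ j' M lo a hxg hg0 hg1 ha (by omega) hS
  have hS' : T ≤ 2 * (hi : ℝ) ∨ j' + 1 ≤ hi := by
    rcases hS with h2 | h2
    · left
      have : (lo : ℝ) ≤ hi := by exact_mod_cast hlt.le
      linarith
    · right; omega
  have h₂ := slice_point_decAtT x T g γ j' M hi a hxg hg0 hg1 ha hhi hS'
  have hm := decAtT_mixture (1 - γ) (by linarith [hγ.2]) (by linarith [hγ.1]) h₁ h₂
  have e : slice (fun t => TP[lo, hi, γ, t]) a g
      = fun h => (1 - γ) * slice (fun t => TP[lo, lo, γ, t]) a g h + (1 - (1 - γ)) * slice (fun t => TP[hi, hi, γ, t]) a g h := by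
    funext h
    simp only [slice_TP]
    ring
  rw [e]; exact hm

/-- **(LB)-piece, modulo `LightTwoBlobDEC`**: the slice of a light credit pair `{lo, hi; γ}` with `hi + a ≤ j′` is `LAW2[hi−lo, γ; a, g]`
shifted by `lo`; the typed statement at layer `j′ − lo` plus the double shift bonus give DEC(j′) at every target `T' ≤ 2lo + (hi−lo)κ_x(γ) + ag`.
[this work] -/
theorem slice_lightBelow_decAtT (hL : LightTwoBlobDEC) (x T' g γ : ℝ) (j' M lo hi a : ℕ) (hx0 : 0 < x) (hx1 : x < 1)
    (hxg : x ≤ g) (hg1 : g ≤ 1) (hγ0 : x ^ 2 < γ) (hγx : γ < x) (ha : 1 ≤ a) (hlt : lo < hi) (hhia : hi + a ≤ j') (hhi : hi ≤ M)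
    (hT' : T' ≤ 2 * (lo : ℝ) + ((hi : ℝ) - lo) * ((γ - x ^ 2) / (1 - x)) + (a : ℝ) * g) :
    DECAtT x T' j' (M + a) (slice (fun t => TP[lo, hi, γ, t]) a g) := by
  classical
  obtain ⟨b, hb⟩ : ∃ b, hi = lo + b := ⟨hi - lo, by omega⟩
  have hb1 : 1 ≤ b := by omega
  have hdec := hL x γ g a b (j' - lo) hx0 hx1 hγ0 hγx hxg hg1 ha hb1 (by omega)
  have hsh := decAtT_shift_two x ((b : ℝ) * ((γ - x ^ 2) / (1 - x)) + (a : ℝ) * g) (j' - lo) (b + a) lo _ hdec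
  have hlay : j' - lo + lo = j' := by omega
  rw [hlay] at hsh
  have hsh' := decAtT_mono_top hsh (show b + a + lo ≤ M + a by omega)
  have htar : T' ≤ (b : ℝ) * ((γ - x ^ 2) / (1 - x)) + (a : ℝ) * g + 2 * (lo : ℝ) := by
    have : ((hi : ℝ) - lo) = b := by rw [hb]; push_cast; ring
    rw [this] at hT'; linarith
  have hfin := decAtT_antitone_target htar hsh'
  have e : (fun h => if lo ≤ h then (fun h => LAW2[b, γ, a, g, h]) (h - lo) else 0) = slice (fun t => TP[lo, hi, γ, t]) a g := by
    funext h
    rw [slice_TP]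
    beta_reduce
    by_cases hlo : lo ≤ h
    · rw [if_pos hlo]
      have e0 : (h - lo = 0) ↔ (h = lo) := by omega
      have e1 : (h - lo = b) ↔ (h = hi) := by omega
      have e2 : (h - lo = a) ↔ (h = lo + a) := by omega
      have e3 : (h - lo = b + a) ↔ (h = hi + a) := by omega
      simp only [e0, e1, e2, e3]
      ring
    · rw [if_neg hlo, if_neg (by omega), if_neg (by omega), if_neg (by omega), if_neg (by omega)]
      ring
  rw [e] at hfin
  exact hfin

/-! ### SL without light straddlers, modulo the typed statement -/

/-- **SL WITH ONE HYPOTHESIS FOR DATA WITHOUT LIGHT STRADDLERS, MODULO `LightTwoBlobDEC`.**  Floor `0 < x < 1`, blob `(a ≥ 1, x ≤ g ≤ 1)`: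
`BDECAtT x T j′ M a μ → DECAtT x (T + a·g) j′ (M + a) (slice μ a g)`.  Heavy pieces by `…QuantSliceHeavy`, (L0) by `slice_selfPair_decAtT`,
(LB) by `slice_lightBelow_decAtT`. [this work] -/
theorem slice_decAtT_of_bdecAtT (hL : LightTwoBlobDEC) (x T g : ℝ) (j' M a : ℕ) (μ : ℕ → ℝ) (hx0 : 0 < x) (hx1 : x < 1)
    (hxg : x ≤ g) (hg1 : g ≤ 1) (ha : 1 ≤ a) (h : BDECAtT x T j' M a μ) :
    DECAtT x (T + (a : ℝ) * g) j' (M + a) (slice μ a g) := by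
  classical
  obtain ⟨ρ, hρ, lam, gg, lo, hi, h0, h1, hgg, hlohi, hhi, hμ, hval⟩ := h
  have hg0 : 0 ≤ g := hx0.le.trans hxg
  have hmix : ∀ t, slice μ a g t = ∑ r, lam r * slice (fun s => TP[lo r, hi r, gg r, s]) a g t := by
    intro t
    simp only [slice]
    rw [hμ t]
    have e2 : (if a ≤ t then μ (t - a) else 0) = ∑ r, lam r * (if a ≤ t then TP[lo r, hi r, gg r, t - a] else 0) := by
      split_ifs with hat
      · rw [hμ (t - a)]
      · simp
    rw [e2, Finset.mul_sum, Finset.mul_sum, ← Finset.sum_add_distrib]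
    refine Finset.sum_congr rfl fun r _ => ?_
    ring
  refine decAtT_finite_mixture x _ j' (M + a) (slice μ a g) lam (fun r => slice (fun s => TP[lo r, hi r, gg r, s]) a g)
    h0 h1 hmix fun r hr => ?_
  rcases hval r hr with hH | ⟨hlt, hS⟩ | ⟨hlt, hhia, hγ0, hγx, hcr⟩
  · -- heavy kinds: reuse the heavy theorem on the single component
    have hsingle : HDECAtT x T j' M (fun s => TP[lo r, hi r, gg r, s]) :=
      ⟨Unit, inferInstance, fun _ => 1, fun _ => gg r, fun _ => lo r, fun _ => hi r, fun _ => zero_le_one, by simp,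
        fun _ => hgg r, fun _ => hlohi r, fun _ => hhi r, fun s => by simp, fun _ _ => hH⟩
    exact slice_decAtT_of_hdecAtT x T g j' M a _ hx0 hx1 hxg hg1 ha hsingle
  · exact slice_selfPair_decAtT x T g (gg r) j' M (lo r) (hi r) a hxg hg0 hg1 (hgg r) ha hlt (hhi r) hS
  · exact slice_lightBelow_decAtT hL x _ g (gg r) j' M (lo r) (hi r) a hx0 hx1 hxg hg1 hγ0 hγx ha hlt hhia (hhi r) (by linarith)

end LawDec

end Quant

end Summit.CriticalPhenomena.PercolationContinuityZ3.Theorems
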